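import Summits.HodgeConjecture.HodgeConjecture.Theses.HolomorphicityRate
import Literature.AlgebraicGeometry.HodgeTheory.HodgeTypeConjugation
import Literature.AlgebraicGeometry.HodgeTheory.AlgebraicClassesHodgeTypeHolds
import Literature.Geometry.Kaehler.HermitianMetricExists
import Literature.Geometry.Kaehler.SmoothHermitianBundleChernCharacter
import Literature.Geometry.Kaehler.ChernCharacterIndependenceProofs
import HarnessLib

/-!
# Strategist r1 sketch — crux `CarrierCurvatureDecay` (stmt-HodgeConjecture-18021)

REDIRECT analysis (cstrat r1, 2026-08-17). The crux R1a as filed asks, for EVERY rational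
`(p,p)`-class `c`, for a rank-`p` carrier `F` with `c_i(F) = 0 (0 < i < p)` and
`(-1)^{p-1}(p-1)!·ch_p(F) = m·A^*c` EXACTLY. This file records, kernel-checked:

* `CarrierCurvatureDecayRelaxed` (R1a′) — the same statement with a degree-`p` ALGEBRAIC SLACK:
  `(-1)^{p-1}(p-1)!·ch_p(F) = m·A^*c + A^*b` for some rational `b ∈ algebraicClasses X p`;
* `relaxed_of_original : CarrierCurvatureDecay → CarrierCurvatureDecayRelaxed` (`b = 0`);
* `relaxed_of_hodgeConjecture : HodgeConjecture → CarrierCurvatureDecayRelaxed` — the summit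
  implies R1a′ outright (trivial rank-`p` bundle, trivial flat connection, `b = -c`, a Hermitian
  metric from `exists_isHermitian_contMDiffRiemannianMetric`), so R1a′ is a CONSEQUENCE of `S`
  (the `S → C` probe that FAILS for R1a succeeds for R1a′ by a four-line proof);
* `RateGapPinnedRelaxed`, `RateGapPinnedOfCarriersRelaxed` — the waypoint / glue with the slack,
  and `rateGapPinnedOfCarriersRelaxed_holds` — the glue′ is provable now (sorry-free here);
* `rateGapPinnedOfCarriers_holds : RateGapPinnedOfCarriers` — the route's OWN glue item
  (stmt-HodgeConjecture-18208) proved verbatim, sorry-free (candidate proof for a prover to land);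
* `closes'` — the route's deciding theorem with R1a′ in place of R1a and glue′ in place of the
  glue, every other binder (R1b = `AHGlobalisationWithRate`, R2″ = `SuperThresholdRigidityLocal`,
  `PolarisedLefschetzData`, `AnalyticSupportAlgebraic`, `HodgeModelsExist`) VERBATIM: sorry-free.

Upshot: the exact Chern normalisation makes R1a strictly STRONGER than the route needs by an
HC-irrelevant open problem (approximate Hartshorne–Serre: e.g. `X = ℙⁿ, n ≥ 5, p = 2, c = h²`,
where HC is empty but no exact carrier is known), while R1a′ keeps `closes` intact and is implied
by the summit. Recommendation to the tenure / repair planner: restate R1a as R1a′ (new item), swap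
glue 18208 / waypoint 18079 for the primed versions, re-certify `closes` as `closes'` below.
-/

noncomputable section

namespace Summit.HodgeConjecture.HodgeConjecture.Cruxes.CarrierCurvatureDecay.StrategistR1

open scoped Manifold ContDiff Topology
open Literature.AlgebraicGeometry.HodgeTheory Literature.AlgebraicGeometry.Motives
  Literature.Geometry.Kaehler
open Summit.HodgeConjecture.HodgeConjecture.Theses.HolomorphicityRate

/-- **R1a′ — carriers with super-threshold curvature decay, up to a degree-`p` algebraic slack.**
As `CarrierCurvatureDecay`, except that the top Chern identity reads
`(-1)^{p-1}(p-1)!·ch_p(F) = m·A^*c + A^*b` for some RATIONAL class `b ∈ algebraicClasses X p`. -/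
def CarrierCurvatureDecayRelaxed : Prop :=
  ∀ (n p : ℕ) (X : SchemeOver ℂ), IsSmoothProjective n X → 1 ≤ p → p < n →
    ∀ (A : HodgeModel n X), A.IsChernNormalised → ∀ (c : complexBetti X (2 * p)),
      IsRationalClass c → A.pullback (2 * p) c ∈ A.hodgePQ (2 * p) p p →
      ∃ (g : Bundle.ContMDiffRiemannianMetric 𝓘(ℝ, A.model) ((⊤ : ℕ∞) : WithTop ℕ∞) A.model
          (fun x : A.carrier => TangentSpace 𝓘(ℝ, A.model) x))
        (F : SmoothHermitianBundle A.model A.carrier) (m : ℕ) (C δ : ℝ)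
        (D : ℕ → UnitaryConnection A.model F.Fiber F.metric) (b : complexBetti X (2 * p)),
        0 < m ∧ 0 < δ ∧ F.rank = p ∧ (∀ i : ℕ, 0 < i → i < p → F.chernCharacter A.deRham i = 0) ∧
        IsRationalClass b ∧ b ∈ algebraicClasses X p ∧
        ((-1 : ℂ) ^ (p - 1) * ((p - 1).factorial : ℂ)) • F.chernCharacter A.deRham p =
          (m : ℂ) • A.pullback (2 * p) c + A.pullback (2 * p) b ∧
        ∀ᶠ k : ℕ in Filter.atTop, ∀ (x : A.carrier) (v w : TangentSpace 𝓘(ℝ, A.model) x),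
          endNormSq (F.metric.frameOp x x) ((D k).curvature x x ![v, w]) ≤
              (C * (k : ℝ) ^ (1 - δ)) ^ 2 * (g.inner x v v * g.inner x w w) ∧
            endNormSq (F.metric.frameOp x x) ((D k).curvatureZeroTwo x x ![v, w]) ≤
              (C * (k : ℝ) ^ (1 - (p : ℝ) - δ)) ^ 2 * (g.inner x v v * g.inner x w w)

/-- **Waypoint′ — the rate gap on the pinned ray, with the algebraic slack.** As `RateGapPinned`,
the carried class being `m·c + b + (a_k d)·h^p` for some rational `b ∈ algebraicClasses X p`. -/
def RateGapPinnedRelaxed : Prop :=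
  ∀ (n p : ℕ) (X : SchemeOver ℂ), IsSmoothProjective n X → 1 ≤ p → p < n →
    ∀ (A : HodgeModel n X), A.IsChernNormalised → ∀ (Λ : HardLefschetzNFold n X),
      IsKaehlerClass n X Λ.hyperplaneClass → ∀ (c : complexBetti X (2 * p)), IsRationalClass c →
      IsOfHodgeType n X (2 * p) p p c →
      ∃ (g : Bundle.ContMDiffRiemannianMetric 𝓘(ℝ, A.model) ((⊤ : ℕ∞) : WithTop ℕ∞) A.model
          (fun x : A.carrier => TangentSpace 𝓘(ℝ, A.model) x))
        (m d : ℕ) (C : ℝ) (a : ℕ → ℕ) (δ C' : ℝ) (b : complexBetti X (2 * p)),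
        0 < m ∧ 0 < d ∧ (∀ k, (a k : ℝ) ≤ C * (k : ℝ) ^ p) ∧ 0 < δ ∧
        IsRationalClass b ∧ b ∈ algebraicClasses X p ∧
        ∃ᶠ k : ℕ in Filter.atTop, ∃ S Sg : Set A.carrier,
          IsNearlyHolomorphicCycleSupport g.toRiemannianMetric p (C' * (k : ℝ) ^ (-((p : ℝ) + δ))) S Sg ∧
          Literature.AlgebraicTopology.SingularHomology.singularCohomology.map ℂ ℂ
              (⟨Subtype.val, continuous_subtype_val⟩ : C({x : A.carrier // x ∉ S}, A.carrier)) (2 * p)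
              (A.pullback (2 * p)
                ((m : ℂ) • c + b + ((a k * d : ℕ) : ℂ) • cupPowTwo Λ.hyperplaneClass p)) = 0

/-- **Glue′** of the relaxed carrier split. -/
def RateGapPinnedOfCarriersRelaxed : Prop :=
  CarrierCurvatureDecayRelaxed → AHGlobalisationWithRate → RateGapPinnedRelaxed

/-! ### R1a′ is weaker than R1a and is implied by the summit -/

/-- The filed crux implies its relaxation (slack `b = 0`). -/
theorem relaxed_of_original (h : CarrierCurvatureDecay) : CarrierCurvatureDecayRelaxed := by
  intro n p X hX hp1 hpn A hA c hc hH
  obtain ⟨g, F, m, C, δ, D, hm, hδ, hrank, hlow, htop, hdec⟩ := h n p X hX hp1 hpn A hA c hc hH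
  exact ⟨g, F, m, C, δ, D, 0, hm, hδ, hrank, hlow, IsRationalClass.zero, Submodule.zero_mem _,
    by rw [map_zero, add_zero]; exact htop, hdec⟩

/-- **The Hodge conjecture implies R1a′** (whereas no implication `HC → R1a` is known: at
`(ℙⁿ, p = 2, c = h²)`, `n ≥ 5`, HC is empty and R1a is approximate Hartshorne). Witness: the
trivial Hermitian bundle of rank `p` with its trivial flat unitary connection (all curvature
bounds hold with `C = 0`), `m = 1`, `b = -c` (algebraic by HC, rational as `(-1 : ℚ) • c`), and a
smooth Hermitian metric, which every Hodge model carries. -/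
theorem relaxed_of_hodgeConjecture (hHC : _root_.HodgeConjecture) : CarrierCurvatureDecayRelaxed := by
  intro n p X hX hp1 hpn A hA c hc hH
  have hcalg : c ∈ algebraicClasses X p := (hHC hX).2 p c hc ⟨A, hH⟩
  obtain ⟨g, -⟩ := exists_isHermitian_contMDiffRiemannianMetric (E := A.model) (M := A.carrier)
  refine ⟨g, SmoothHermitianBundle.trivial A.model A.carrier (EuclideanSpace ℂ (Fin p)), 1, 0, 1,
    fun _ => UnitaryConnection.trivial A.model A.carrier (EuclideanSpace ℂ (Fin p)),
    ((-1 : ℚ) : ℂ) • c, Nat.one_pos, one_pos, ?_, ?_, hc.smul (-1), Submodule.smul_mem _ _ hcalg,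
    ?_, Filter.Eventually.of_forall fun k x v w => ?_⟩
  · rw [SmoothHermitianBundle.rank_trivial, finrank_euclideanSpace_fin]
  · intro i hi hip
    obtain ⟨j, rfl⟩ : ∃ j, i = j + 1 := ⟨i - 1, by omega⟩
    exact SmoothHermitianBundle.chernCharacter_trivial_succ
      (SmoothComplexVectorBundle.mk_eq_mk_of_isChernCharacterForm_holds A.model A.carrier) _ A.deRham j
  · obtain ⟨q, rfl⟩ : ∃ q, p = q + 1 := ⟨p - 1, by omega⟩
    rw [SmoothHermitianBundle.chernCharacter_trivial_succ
      (SmoothComplexVectorBundle.mk_eq_mk_of_isChernCharacterForm_holds A.model A.carrier) _ A.deRham q,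
      smul_zero, map_smul]
    push_cast
    simp
  · erw [UnitaryConnection.trivial_curvature, UnitaryConnection.trivial_curvatureZeroTwo]
    simp

/-! ### The glue′ is provable now -/

/-- **Glue′ (sorry-free).** Take the carrier `(g, F, m, C, δ, D, b)` of R1a′ for `(A, c)`; feed it
to R1b with `(Λ, g)`; the eventually-in-`k` zero loci `S_k` (`Sg = ∅`) carry
`(-1)^{p-1}(p-1)! ch_p(F) + (k^p d) A^*h^p = A^*(m c + b + (k^p d) h^p)`; `a_k := k^p`, `C := 1`. -/
theorem rateGapPinnedOfCarriersRelaxed_holds : RateGapPinnedOfCarriersRelaxed := by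
  intro h₁ h₂ n p X hX hp1 hpn A hA Λ hΛK c hc hH
  obtain ⟨g, F, m, C, δ, D, b, hm, hδ, hrank, hlow, hb, hbalg, htop, hdec⟩ :=
    h₁ n p X hX hp1 hpn A hA c hc (hH.mem_hodgePQ hX A)
  obtain ⟨d, C', hd, hev⟩ := h₂ n p X hX hp1 hpn A hA Λ hΛK g F C δ D hδ hrank hlow hdec
  refine ⟨g, m, d, 1, fun k => k ^ p, δ, C', b, hm, hd, fun k => by push_cast; simp, hδ, hb, hbalg,
    (hev.mono fun k hk => ?_).frequently⟩
  obtain ⟨S, hS, hcar⟩ := hk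
  refine ⟨S, ∅, hS, ?_⟩
  have key : A.pullback (2 * p) ((m : ℂ) • c + b + ((k ^ p * d : ℕ) : ℂ) • cupPowTwo Λ.hyperplaneClass p) =
      ((-1 : ℂ) ^ (p - 1) * ((p - 1).factorial : ℂ)) • F.chernCharacter A.deRham p +
        ((k ^ p * d : ℕ) : ℂ) • A.pullback (2 * p) (cupPowTwo Λ.hyperplaneClass p) := by
    rw [map_add, map_add, map_smul, map_smul, htop]
  simpa only [key] using hcar

/-- **The route's own glue (item stmt-HodgeConjecture-18208), sorry-free** — the same proof with
`b = 0`; recorded so that a prover can land it verbatim (candidate proof attached as evidence). -/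
theorem rateGapPinnedOfCarriers_holds : RateGapPinnedOfCarriers := by
  intro h₁ h₂ n p X hX hp1 hpn A hA Λ hΛK c hc hH
  obtain ⟨g, F, m, C, δ, D, hm, hδ, hrank, hlow, htop, hdec⟩ :=
    h₁ n p X hX hp1 hpn A hA c hc (hH.mem_hodgePQ hX A)
  obtain ⟨d, C', hd, hev⟩ := h₂ n p X hX hp1 hpn A hA Λ hΛK g F C δ D hδ hrank hlow hdec
  refine ⟨g, m, d, 1, fun k => k ^ p, δ, C', hm, hd, fun k => by push_cast; simp, hδ,
    (hev.mono fun k hk => ?_).frequently⟩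
  obtain ⟨S, hS, hcar⟩ := hk
  refine ⟨S, ∅, hS, ?_⟩
  have key : A.pullback (2 * p) ((m : ℂ) • c + ((k ^ p * d : ℕ) : ℂ) • cupPowTwo Λ.hyperplaneClass p) =
      ((-1 : ℂ) ^ (p - 1) * ((p - 1).factorial : ℂ)) • F.chernCharacter A.deRham p +
        ((k ^ p * d : ℕ) : ℂ) • A.pullback (2 * p) (cupPowTwo Λ.hyperplaneClass p) := by
    rw [map_add, map_smul, map_smul, htop]
  simpa only [key] using hcar

/-! ### The deciding theorem with R1a′ in place of R1a -/

/-- **`closes'`** — the route's deciding theorem over R1a′ / glue′, all other binders verbatim.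
Difference from `closes`: the waypoint′ output for `c` carries `m·c + b + (a_k d) h^p`; apply R2″
to the rational `(p,p)` class `c' := c + m⁻¹ b` (so `m·c' = m·c + b`), then subtract BOTH
algebraic summands `b` and `(a_k d) h^p` before dividing by `m`. -/
theorem closes' (h₁ : CarrierCurvatureDecayRelaxed) (h₂ : AHGlobalisationWithRate)
    (h₃ : RateGapPinnedOfCarriersRelaxed) (h₄ : SuperThresholdRigidityLocal)
    (h₅ : PolarisedLefschetzData) (h₆ : AnalyticSupportAlgebraic) (h₇ : HodgeModelsExist) :
    _root_.HodgeConjecture := by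
  intro n X hX
  refine ⟨h₇ n X hX, ?_⟩
  obtain ⟨Λ, hΛK, hΛalg⟩ := h₅ n X hX
  have hR : RateGapPinnedRelaxed := h₃ h₁ h₂
  -- the lower half of the Hodge diamond: `2p ≤ n`
  have lower : ∀ p : ℕ, 2 * p ≤ n → ∀ c : complexBetti X (2 * p), IsRationalClass c →
      IsOfHodgeType n X (2 * p) p p c → c ∈ algebraicClasses X p := by
    intro p h2p c hc hH
    rcases Nat.eq_zero_or_pos p with rfl | hp1
    · rw [algebraicClasses_zero]
      exact Submodule.mem_top
    · have hpn : p < n := by omega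
      obtain ⟨A₀, -⟩ := id hH
      have hA : A₀.chernNormalise.IsChernNormalised := A₀.isChernNormalised_chernNormalise
      obtain ⟨g, m, d, C, a, δ, C', b, hm, hd, hbud, hδ, hb, hbalg, hfreq⟩ :=
        hR n p X hX hp1 hpn A₀.chernNormalise hA Λ hΛK c hc hH
      have hm0 : (m : ℂ) ≠ 0 := Nat.cast_ne_zero.2 hm.ne'
      -- the rational `(p,p)` class `c' := c + m⁻¹ b`, with `m c' = m c + b`
      set c' : complexBetti X (2 * p) := c + (((m : ℚ)⁻¹ : ℚ) : ℂ) • b with hc'def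
      have hc'r : IsRationalClass c' := hc.add (hb.smul _)
      have hc'H : IsOfHodgeType n X (2 * p) p p c' :=
        hH.add hX ((isOfHodgeType_of_mem_algebraicClasses_of_isSmoothProjective hX p hbalg).smul _)
      have key : (m : ℂ) • c' = (m : ℂ) • c + b := by
        rw [hc'def, smul_add, smul_smul, Rat.cast_inv, Rat.cast_natCast, mul_inv_cancel₀ hm0, one_smul]
      obtain ⟨ρ, -, hev⟩ :=
        h₄ n p X hX hp1 hpn A₀.chernNormalise Λ hΛK g c' m d C a δ C' hc'r hc'H hm hd hbud hδ
      obtain ⟨k, ⟨S, Sg, hS, hcar⟩, hk⟩ := (hfreq.and_eventually hev).exists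
      rw [← key] at hcar
      obtain ⟨T, hT, hsupp, -⟩ := hk S Sg hS hcar
      have hmem : ((m : ℂ) • c' + ((a k * d : ℕ) : ℂ) • cupPowTwo Λ.hyperplaneClass p) ∈
          algebraicClasses X p :=
        h₆ n p X hX A₀.chernNormalise _ T hT hsupp
      rw [key] at hmem
      have hh : (((a k * d : ℕ) : ℂ) • cupPowTwo Λ.hyperplaneClass p) ∈ algebraicClasses X p :=
        Submodule.smul_mem _ _ (hΛalg p)
      have hmc : ((m : ℂ) • c) ∈ algebraicClasses X p := by
        have h := Submodule.sub_mem _ (Submodule.sub_mem _ hmem hh) hbalg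
        rwa [add_sub_cancel_right, add_sub_cancel_right] at h
      have h := Submodule.smul_mem _ ((m : ℂ)⁻¹) hmc
      rwa [smul_smul, inv_mul_cancel₀ hm0, one_smul] at h
  intro p c hc hH
  by_cases h2p : 2 * p ≤ n
  · exact lower p h2p c hc hH
  · exact Λ.mem_algebraicClasses_of_lt (by omega) (fun c' hc' hH' ↦ lower (n - p) (by omega) c' hc' hH') c hc hH

/-! ### Import-light variant (the Hodge-type bookkeeping moved into the glue)

The route file deliberately keeps the Morse-theoretic module behind
`isOfHodgeType_of_mem_algebraicClasses_of_isSmoothProjective` / `hodgePQ_independent_of_hodgeModel`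
out of its imports (docstring of item 18079). Variant ″ below puts the passage `c ↦ c' := c + m⁻¹ b`
into the WAYPOINT, so that the deciding theorem `closes''` is again logic + submodule arithmetic
only (no Hodge-type lemma), while the glue″ — a Theorems-side proof with free imports — does the
bookkeeping. Both are sorry-free here. -/

/-- **Waypoint″** — as `RateGapPinned` for an auxiliary rational `(p,p)` class `c'` with
`m·c' = m·c + b`, `b ∈ algebraicClasses X p`. -/
def RateGapPinnedRelaxed' : Prop :=
  ∀ (n p : ℕ) (X : SchemeOver ℂ), IsSmoothProjective n X → 1 ≤ p → p < n →
    ∀ (A : HodgeModel n X), A.IsChernNormalised → ∀ (Λ : HardLefschetzNFold n X),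
      IsKaehlerClass n X Λ.hyperplaneClass → ∀ (c : complexBetti X (2 * p)), IsRationalClass c →
      IsOfHodgeType n X (2 * p) p p c →
      ∃ (c' b : complexBetti X (2 * p))
        (g : Bundle.ContMDiffRiemannianMetric 𝓘(ℝ, A.model) ((⊤ : ℕ∞) : WithTop ℕ∞) A.model
          (fun x : A.carrier => TangentSpace 𝓘(ℝ, A.model) x))
        (m d : ℕ) (C : ℝ) (a : ℕ → ℕ) (δ C' : ℝ),
        IsRationalClass c' ∧ IsOfHodgeType n X (2 * p) p p c' ∧ b ∈ algebraicClasses X p ∧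
        (m : ℂ) • c' = (m : ℂ) • c + b ∧
        0 < m ∧ 0 < d ∧ (∀ k, (a k : ℝ) ≤ C * (k : ℝ) ^ p) ∧ 0 < δ ∧
        ∃ᶠ k : ℕ in Filter.atTop, ∃ S Sg : Set A.carrier,
          IsNearlyHolomorphicCycleSupport g.toRiemannianMetric p (C' * (k : ℝ) ^ (-((p : ℝ) + δ))) S Sg ∧
          Literature.AlgebraicTopology.SingularHomology.singularCohomology.map ℂ ℂ
              (⟨Subtype.val, continuous_subtype_val⟩ : C({x : A.carrier // x ∉ S}, A.carrier)) (2 * p)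
              (A.pullback (2 * p)
                ((m : ℂ) • c' + ((a k * d : ℕ) : ℂ) • cupPowTwo Λ.hyperplaneClass p)) = 0

/-- **Glue″**. -/
def RateGapPinnedOfCarriersRelaxed' : Prop :=
  CarrierCurvatureDecayRelaxed → AHGlobalisationWithRate → RateGapPinnedRelaxed'

/-- Glue″ is provable now (from glue′ and the `c'` construction; this is where the Hodge-type
lemma for algebraic classes is spent). -/
theorem rateGapPinnedOfCarriersRelaxed'_holds : RateGapPinnedOfCarriersRelaxed' := by
  intro h₁ h₂ n p X hX hp1 hpn A hA Λ hΛK c hc hH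
  obtain ⟨g, m, d, C, a, δ, C', b, hm, hd, hbud, hδ, hb, hbalg, hfreq⟩ :=
    rateGapPinnedOfCarriersRelaxed_holds h₁ h₂ n p X hX hp1 hpn A hA Λ hΛK c hc hH
  have hm0 : (m : ℂ) ≠ 0 := Nat.cast_ne_zero.2 hm.ne'
  set c' : complexBetti X (2 * p) := c + (((m : ℚ)⁻¹ : ℚ) : ℂ) • b with hc'def
  have key : (m : ℂ) • c' = (m : ℂ) • c + b := by
    rw [hc'def, smul_add, smul_smul, Rat.cast_inv, Rat.cast_natCast, mul_inv_cancel₀ hm0, one_smul]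
  refine ⟨c', b, g, m, d, C, a, δ, C', hc.add (hb.smul _),
    hH.add hX ((isOfHodgeType_of_mem_algebraicClasses_of_isSmoothProjective hX p hbalg).smul _),
    hbalg, key, hm, hd, hbud, hδ, hfreq.mono fun k hk => ?_⟩
  obtain ⟨S, Sg, hS, hcar⟩ := hk
  exact ⟨S, Sg, hS, by rw [key]; exact hcar⟩

/-- **`closes''`** — deciding theorem over R1a′ / glue″: logic + `ℂ`-submodule arithmetic only. -/
theorem closes'' (h₁ : CarrierCurvatureDecayRelaxed) (h₂ : AHGlobalisationWithRate)
    (h₃ : RateGapPinnedOfCarriersRelaxed') (h₄ : SuperThresholdRigidityLocal)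
    (h₅ : PolarisedLefschetzData) (h₆ : AnalyticSupportAlgebraic) (h₇ : HodgeModelsExist) :
    _root_.HodgeConjecture := by
  intro n X hX
  refine ⟨h₇ n X hX, ?_⟩
  obtain ⟨Λ, hΛK, hΛalg⟩ := h₅ n X hX
  have hR : RateGapPinnedRelaxed' := h₃ h₁ h₂
  have lower : ∀ p : ℕ, 2 * p ≤ n → ∀ c : complexBetti X (2 * p), IsRationalClass c →
      IsOfHodgeType n X (2 * p) p p c → c ∈ algebraicClasses X p := by
    intro p h2p c hc hH
    rcases Nat.eq_zero_or_pos p with rfl | hp1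
    · rw [algebraicClasses_zero]
      exact Submodule.mem_top
    · have hpn : p < n := by omega
      obtain ⟨A₀, -⟩ := id hH
      have hA : A₀.chernNormalise.IsChernNormalised := A₀.isChernNormalised_chernNormalise
      obtain ⟨c', b, g, m, d, C, a, δ, C', hc'r, hc'H, hbalg, key, hm, hd, hbud, hδ, hfreq⟩ :=
        hR n p X hX hp1 hpn A₀.chernNormalise hA Λ hΛK c hc hH
      have hm0 : (m : ℂ) ≠ 0 := Nat.cast_ne_zero.2 hm.ne'
      obtain ⟨ρ, -, hev⟩ :=
        h₄ n p X hX hp1 hpn A₀.chernNormalise Λ hΛK g c' m d C a δ C' hc'r hc'H hm hd hbud hδ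
      obtain ⟨k, ⟨S, Sg, hS, hcar⟩, hk⟩ := (hfreq.and_eventually hev).exists
      obtain ⟨T, hT, hsupp, -⟩ := hk S Sg hS hcar
      have hmem : ((m : ℂ) • c' + ((a k * d : ℕ) : ℂ) • cupPowTwo Λ.hyperplaneClass p) ∈
          algebraicClasses X p :=
        h₆ n p X hX A₀.chernNormalise _ T hT hsupp
      rw [key] at hmem
      have hh : (((a k * d : ℕ) : ℂ) • cupPowTwo Λ.hyperplaneClass p) ∈ algebraicClasses X p :=
        Submodule.smul_mem _ _ (hΛalg p)
      have hmc : ((m : ℂ) • c) ∈ algebraicClasses X p := by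
        have h := Submodule.sub_mem _ (Submodule.sub_mem _ hmem hh) hbalg
        rwa [add_sub_cancel_right, add_sub_cancel_right] at h
      have h := Submodule.smul_mem _ ((m : ℂ)⁻¹) hmc
      rwa [smul_smul, inv_mul_cancel₀ hm0, one_smul] at h
  intro p c hc hH
  by_cases h2p : 2 * p ≤ n
  · exact lower p h2p c hc hH
  · exact Λ.mem_algebraicClasses_of_lt (by omega) (fun c' hc' hH' ↦ lower (n - p) (by omega) c' hc' hH') c hc hH

end Summit.HodgeConjecture.HodgeConjecture.Cruxes.CarrierCurvatureDecay.StrategistR1
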